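import Summits.BirchSwinnertonDyer.BirchSwinnertonDyer.Theorems.TameQuarticSolventSolventPairLowerBoundKolyvaginTwistedUpperAnalyticHalf
import Summits.BirchSwinnertonDyer.BirchSwinnertonDyer.Theorems.TameQuarticSolventSolventPairLowerBoundPairGivenGoodFieldOf
import Literature.NumberTheory.EllipticCurves.NonvanishingTwistsRealQuadraticTameAtThree
import HarnessLib

/-!
# Route `TameQuarticSolvent`, crux `SolventPairLowerBound` (stmt-BirchSwinnertonDyer-21391), line `birth` —
# the ANALYTIC HALF of K2(a) on EVERY row with a multiplicative prime `ℓ₀ ≠ 3`, the prime `2` included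

HONEST FRAMING. Theorems only; helper (`--supports stmt-BirchSwinnertonDyer-21391`, width seat `bsd-wall-tqs-p1-w2`,
gen 2). Companion of `…KolyvaginTwistedUpperAnalyticHalf.lean` (p584089), which produces — for `W` on the leaf with an
ODD multiplicative prime `ℓ₀ ≠ 3` (3 462 / 3 533 census classes) — a totally positive `β ∈ K = ℚ(√d)` of odd valuation
above `3` with `L((W_K)^{(β)}, s)` entire and `L((W_K)^{(β)}, 1) ≠ 0`, so that the Euler-system half of K2(a) may be
asked in analytic rank ZERO. Skeleton v6 of the crux therefore files the 52 classes whose ONLY multiplicative prime is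
`2` under the residual stub `stub_kolyvaginTwistedUpperOverK_noOddMult` (≤ 71 classes). This file removes them from
that residue: the same conclusion for every `W` on the leaf with SOME multiplicative prime `ℓ₀ ≠ 3` (3 514 / 3 533
classes), GIVEN modularity and the named facts `friedbergHoffstein_exists_twist_ne_zero_realQuadratic_tameAtThree_anyMult`
(Friedberg–Hoffstein 1995 Thm. B (1) over `K` in the «flip» class at ANY multiplicative `ℓ₀ ≠ 3`; the flip at a place
`𝔮 ∣ ℓ₀` is the UNRAMIFIED quadratic twist, written uniformly in the residue characteristic via Hecke's decomposition
law, and exchanges split/non-split multiplicative reduction of the Tate curve at `𝔮` whatever the residue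
characteristic — so the sign bookkeeping of the odd case applies verbatim) and `…_noflip`. What remains of K2a-rest
after this file is the v5 K2a text on the 19 census classes with NO multiplicative prime at all (every bad prime
additive; list in `Cruxes/SolventPairLowerBound/PARITY-K2A-w2.md` §2), where the rank-zero road needs a ramified flip
at an additive prime or the rank-one road. The Euler-system half is NOT touched. BSD is not proved by any of this; no
route file is imported.

Proof. Verbatim the proof of p584089 with `ℓ₀ ≠ 2` dropped: `r_an(W) = 1 ⇒ w(W) = −1` (parity from modularity);
(t′) at `3` ⇒ `ord₃ j ≥ 0` and Kodaira `III`/`III*`; `w(W^{(d)}) ∈ {±1}`: if `+1`, the «flip at any multiplicative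
`ℓ₀`» fact at a place `𝔮` of `K` above `ℓ₀`; if `−1`, the «no-flip» fact.
-/

-- D-0017: single-problem summit, so `Summit.BirchSwinnertonDyer.BirchSwinnertonDyer.…` repeats a namespace BY DESIGN.
set_option linter.dupNamespace false

noncomputable section

open scoped Classical NumberField

open IsDedekindDomain NumberField WeierstrassCurve
open Literature.NumberTheory.EllipticCurves
open Literature.NumberTheory.EllipticCurves.ModularForms

namespace Summit.BirchSwinnertonDyer.BirchSwinnertonDyer.Theorems.SolventPairLowerBound

/-- **The analytic half of K2(a) on every row with a multiplicative prime `ℓ₀ ≠ 3` (the prime `2` included).**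
GIVEN modularity (`hmod`) and Friedberg–Hoffstein Thm. B (1) over the real quadratic field in the «flip at any
multiplicative `ℓ₀ ≠ 3`» and «no-flip» classes (`hFH`, `hFH'`): for every non-CM, globally minimal `W/ℚ`, additive of
class (t′) at `3`, of analytic rank `1`, having a prime `ℓ₀ ≠ 3` of multiplicative reduction, every `d > 0` with
`ord₃ d = 1`, and every quadratic number field `K ∋ θ₁` with `θ₁² = d`, there is `β ∈ K`, of odd valuation at every
place above `3` and positive at every real embedding, such that the twist `(W_K)^{(β)}` has an entire `L`-function
NOT vanishing at `s = 1`. Supersedes p584089's `…_of_friedbergHoffstein` (odd `ℓ₀`) on 52 more census classes.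
[cite: FriedbergHoffstein1995, Thm. B (1)] [cite: Hecke1981, §39 Thm. 119] [cite: Kobayashi2002, Thm. 1.1 (i), (ii)]
[cite: BCDTJAMS2001, Thm. A] -/
theorem exists_totallyPositive_oddAtThree_twist_L_ne_zero_of_friedbergHoffstein_anyMult
    (hmod : exists_isNewformOf)
    (hFH : friedbergHoffstein_exists_twist_ne_zero_realQuadratic_tameAtThree_anyMult)
    (hFH' : friedbergHoffstein_exists_twist_ne_zero_realQuadratic_tameAtThree_noflip) :
    ∀ (W : WeierstrassCurve ℚ) [W.IsElliptic] [W.IsGloballyMinimal], ¬ W.HasCM →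
      Literature.NumberTheory.EllipticCurves.Rank1Residual.Addv W 3 →
      Summit.BirchSwinnertonDyer.Rank1Residual.Additive.SubTprime W 3 → W.analyticRank = 1 →
      (∃ (ℓ₀ : ℕ) (_ : Fact ℓ₀.Prime), ℓ₀ ≠ 3 ∧ W.HasMultiplicativeReductionAtPrime ℓ₀) →
      ∀ (d : ℤ), 0 < d → padicValInt 3 d = 1 →
      ∀ (K : Type) [Field K] [NumberField K] (θ₁ : K), Module.finrank ℚ K = 2 → θ₁ ^ 2 = (d : K) →
      ∃ β : K,
        (∀ v : HeightOneSpectrum (𝓞 K), ((3 : ℕ) : 𝓞 K) ∈ v.asIdeal →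
          ∃ k : ℤ, v.valuation K β = WithZero.exp (2 * k + 1)) ∧
        (∀ σ : K →+* ℝ, 0 < σ β) ∧
        ((W.baseChange K).quadraticTwist β).HasEntireLFunction ∧
        ((W.baseChange K).quadraticTwist β).entireLFunction 1 ≠ 0 := by
  intro W _ _ hCM hadd hsub hr hmult d hd hv K _ _ θ₁ h2 hθ₁
  obtain ⟨ℓ₀, hℓp, hℓ3, hℓ⟩ := hmult
  have hw : W.rootNumber = -1 :=
    Summit.BirchSwinnertonDyer.Rank1Residual.O5.HeegnerLogTransport.rootNumber_eq_neg_one_of_analyticRank_eq_one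
      hmod W hr
  have hj : 0 ≤ padicValRat 3 W.j := not_lt.mp hsub.1
  have hIII : W.kodairaSymbolAt (Summit.BirchSwinnertonDyer.Rank1Residual.Additive.placeOf 3) = .III ∨
      W.kodairaSymbolAt (Summit.BirchSwinnertonDyer.Rank1Residual.Additive.placeOf 3) = .IIIstar :=
    (Summit.BirchSwinnertonDyer.Rank1Residual.Additive.subTprime_three_iff_kodairaSymbolAt_III_or_IIIstar
      W hadd).mp hsub
  have hdq : (d : ℚ) ≠ 0 := by exact_mod_cast hd.ne'
  haveI := W.isElliptic_quadraticTwist hdq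
  rcases rootNumber_eq_one_or_eq_neg_one (W.quadraticTwist (d : ℚ)) with hwd | hwd
  · -- `w(W^{(d)}) = +1`: one UNRAMIFIED flip at a place `𝔮` of `K` above the multiplicative prime `ℓ₀` (any `ℓ₀ ≠ 3`)
    obtain ⟨𝔮, h𝔮⟩ := exists_heightOneSpectrum_natCast_mem K ℓ₀
    obtain ⟨β, hβpos, hβval, -, -, -, -, hL, hL1⟩ :=
      hFH W hCM hw hj hIII ℓ₀ hℓ3 hℓ d hd hv hwd K θ₁ h2 hθ₁ 𝔮 h𝔮
    exact ⟨β, hβval, hβpos, hL, hL1⟩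
  · -- `w(W^{(d)}) = −1`: no flip
    obtain ⟨β, hβpos, hβval, -, hL, hL1⟩ := hFH' W hCM hw hj hIII d hd hv hwd K θ₁ h2 hθ₁
    exact ⟨β, hβval, hβpos, hL, hL1⟩

/-- The odd-prime hypothesis of p584089 / skeleton v6 («`W` has an ODD multiplicative prime `ℓ₀ ≠ 3`») implies the
hypothesis of this file («`W` has a multiplicative prime `ℓ₀ ≠ 3`»). [folklore] -/
theorem exists_mult_ne_three_of_exists_oddMult (W : WeierstrassCurve ℚ)
    (h : ∃ (ℓ₀ : ℕ) (_ : Fact ℓ₀.Prime), ℓ₀ ≠ 2 ∧ ℓ₀ ≠ 3 ∧ W.HasMultiplicativeReductionAtPrime ℓ₀) :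
    ∃ (ℓ₀ : ℕ) (_ : Fact ℓ₀.Prime), ℓ₀ ≠ 3 ∧ W.HasMultiplicativeReductionAtPrime ℓ₀ := by
  obtain ⟨ℓ₀, hp, -, h3, hm⟩ := h
  exact ⟨ℓ₀, hp, h3, hm⟩

/-- Conversely, under «no ODD multiplicative prime `ℓ₀ ≠ 3`» (the hypothesis of v6's K2a-rest), «some multiplicative
prime `ℓ₀ ≠ 3`» means that `2` is a prime of multiplicative reduction. [folklore] -/
theorem hasMultiplicativeReductionAtPrime_two_of_noOddMult (W : WeierstrassCurve ℚ)
    (hno : ¬ ∃ (ℓ₀ : ℕ) (_ : Fact ℓ₀.Prime), ℓ₀ ≠ 2 ∧ ℓ₀ ≠ 3 ∧ W.HasMultiplicativeReductionAtPrime ℓ₀)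
    (h : ∃ (ℓ₀ : ℕ) (_ : Fact ℓ₀.Prime), ℓ₀ ≠ 3 ∧ W.HasMultiplicativeReductionAtPrime ℓ₀) :
    @WeierstrassCurve.HasMultiplicativeReductionAtPrime W 2 ⟨Nat.prime_two⟩ := by
  obtain ⟨ℓ₀, hp, h3, hm⟩ := h
  by_cases h2 : ℓ₀ = 2
  · subst h2
    convert hm
  · exact absurd ⟨ℓ₀, hp, h2, h3, hm⟩ hno

end Summit.BirchSwinnertonDyer.BirchSwinnertonDyer.Theorems.SolventPairLowerBound

end
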